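import Mathlib.Analysis.Convex.Measure
import Literature.InformationTheory.Entanglement.TwoRebitSeparabilityProbability
import Literature.Probability.RandomMatrix.TwoQubitSeparabilityVolumesRebitFullProofs
import HarnessLib

/-!
# Two-rebit separability probability `29/64` (Lovas–Andai 2017, Theorem 2): closed versus open
# bodies, and the reduction of `LovasAndai2017_rebit_2964` to the fibre over `½·1₂`

Sibling proof file of `Literature/InformationTheory/Entanglement/TwoRebitSeparabilityProbability.lean`
(the named fact `LovasAndai2017_rebit_2964 : 64 · λ₉(P_ℝ) = 29 · λ₉(D_ℝ)` for the CLOSED bodies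
`rebitPPTBody ⊆ rebitStateBody`, `Matrix.PosSemidef`). Theorem-only; nothing is defined here.

The same theorem is vendored a second time in the tree, typed with Lovas–Andai's OPEN (faithful,
`Matrix.PosDef`) bodies on the literally identical chart `twoRebitMatrix = rebitDensity`:
`Literature.Probability.RandomMatrix.LovasAndai2017_rebit_separability_probability`
(`Literature/Probability/RandomMatrix/TwoQubitSeparabilityVolumes.lean`), where its reduction to the
fibre over the maximally mixed marginal (`…RebitFullProofs.lean`, Cor. 2 of the source by the
congruence `ρ ↦ (1 ⊗ M)ρ(1 ⊗ M)ᵀ`) and Lemma 6 (`LovasAndaiLemma6.lean`) are proved. This file closes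
the gap between the two typings, which both module docstrings describe but neither asserts:

* `rebitDensity_lineComb` — the chart is affine, so the open bodies `{ρ ≻ 0}`, `{ρ ≻ 0, ρ^Γ ≻ 0}`
  are CONVEX (`convex_setOf_posDef_rebitDensity`, `convex_setOf_posDef_ppt`);
* the closed bodies lie between the open ones and their closures (`rebitStateBody_subset_closure`,
  `rebitPPTBody_subset_closure`: the open segment from a state to the maximally mixed state `¼·1`
  consists of faithful states, `(1−t)ρ + t·¼·1 ≻ 0`, and likewise for `ρ^Γ`);
* the frontier of a convex set is Lebesgue-null (`Convex.addHaar_frontier`), hence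
  `λ₉(closed body) = λ₉(open body)` (`volume_rebitStateBody_eq_posDef`,
  `volume_rebitPPTBody_eq_posDef`) — this is the remark "the closed bodies differ from the open
  ones by subsets of the algebraic hypersurfaces `{det ρ = 0}`, `{det ρ^Γ = 0}`, which are
  Lebesgue-null" of the fact file, proved without touching determinants;
* `LovasAndai2017_rebit_2964_iff_posDef` — the two named facts are EQUIVALENT, and
  `LovasAndai2017_rebit_2964_of_fibre` — Theorem 2 in the closed typing follows from the fibre
  statement `LovasAndai2017_rebit_fibre_separability_probability` over `D = ½·1₂` (Cor. 2 + the
  value, exactly the architecture of the printed proof: [LovasAndai2017, p. 8]).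

What is NOT here: the fibre value itself (the `7`-dimensional integral: Schur complement,
singular-value reduction to Lemma 6, and the dilogarithmic integration of Thm. 2).

## References

* [LovasAndai2017] A. Lovas, A. Andai, *Invariance of separability probability over reduced states
  in 4 × 4 bipartite systems*, J. Phys. A 50 (2017) 295303, arXiv:1610.01410: §2 (`𝒟_{n,𝕂}`,
  faithful states), §3 (T, `𝒟ˢ = T(𝒟) ∩ 𝒟`), Corollary 2, Theorem 2.
-/

noncomputable section

open MeasureTheory Set
open scoped ENNReal Matrix

namespace Literature.InformationTheory.Entanglement

open Literature.Probability.RandomMatrix (twoRebitMatrix twoRebitMatrixPT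
  LovasAndai2017_rebit_separability_probability LovasAndai2017_rebit_fibre_separability_probability)

/-! ### The two charts of the tree are the same matrix -/

/-- The chart `rebitDensity` of this topic and the chart `twoRebitMatrix` of
`Literature/Probability/RandomMatrix` are literally the same matrix-valued function.
[cite: LovasAndai2017, §3 (parametrisation ρ(D₁,D₂,C))] -/
theorem rebitDensity_eq_twoRebitMatrix : rebitDensity = twoRebitMatrix := rfl

/-- The two partial-transpose charts coincide as well. [cite: LovasAndai2017, §3 (the involution T)] -/
theorem rebitDensityPT_eq_twoRebitMatrixPT : rebitDensityPT = twoRebitMatrixPT := rfl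

/-! ### The chart is affine; the open bodies are convex -/

/-- The chart `y ↦ ρ(y)` is affine: it maps affine combinations to affine combinations.
[folklore] -/
theorem rebitDensity_lineComb (a b : ℝ) (hab : a + b = 1) (y y' : Fin 9 → ℝ) :
    rebitDensity (a • y + b • y') = a • rebitDensity y + b • rebitDensity y' := by
  ext i j
  fin_cases i <;> fin_cases j <;> simp [rebitDensity, Matrix.add_apply]
  linear_combination (-1 : ℝ) * hab

/-- The partial-transpose chart `y ↦ ρ(y)^Γ` is affine. [folklore] -/
theorem rebitDensityPT_lineComb (a b : ℝ) (hab : a + b = 1) (y y' : Fin 9 → ℝ) :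
    rebitDensityPT (a • y + b • y') = a • rebitDensityPT y + b • rebitDensityPT y' := by
  ext i j
  fin_cases i <;> fin_cases j <;> simp [rebitDensityPT, Matrix.add_apply]
  linear_combination (-1 : ℝ) * hab

/-- The OPEN body of faithful two-rebit states `{y | ρ(y) ≻ 0}` (Lovas–Andai's `𝒟_{4,ℝ}`) is
convex. [cite: LovasAndai2017, §2 (𝒟_{n,𝕂}, D > 0)] -/
theorem convex_setOf_posDef_rebitDensity :
    Convex ℝ {y : Fin 9 → ℝ | (rebitDensity y).PosDef} := by
  intro y hy y' hy' a b ha hb hab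
  simp only [Set.mem_setOf_eq] at hy hy' ⊢
  rw [rebitDensity_lineComb a b hab]
  rcases ha.eq_or_lt with rfl | ha'
  · rw [zero_add] at hab
    subst hab
    simpa using hy'
  · exact (hy.smul ha').add_posSemidef (hy'.posSemidef.smul hb)

/-- The open locus `{y | ρ(y)^Γ ≻ 0}` (Lovas–Andai's `T(𝒟_{4,ℝ})` before intersecting) is convex.
[cite: LovasAndai2017, §3 (T(𝒟_{4,𝕂}))] -/
theorem convex_setOf_posDef_rebitDensityPT :
    Convex ℝ {y : Fin 9 → ℝ | (rebitDensityPT y).PosDef} := by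
  intro y hy y' hy' a b ha hb hab
  simp only [Set.mem_setOf_eq] at hy hy' ⊢
  rw [rebitDensityPT_lineComb a b hab]
  rcases ha.eq_or_lt with rfl | ha'
  · rw [zero_add] at hab
    subst hab
    simpa using hy'
  · exact (hy.smul ha').add_posSemidef (hy'.posSemidef.smul hb)

/-- The OPEN PPT body `{y | ρ(y) ≻ 0 ∧ ρ(y)^Γ ≻ 0}` (Lovas–Andai's `𝒟ˢ_{4,ℝ} = T(𝒟_{4,ℝ}) ∩ 𝒟_{4,ℝ}`)
is convex. [cite: LovasAndai2017, §3 (𝒟ˢ = T(𝒟) ∩ 𝒟)] -/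
theorem convex_setOf_posDef_ppt :
    Convex ℝ {y : Fin 9 → ℝ | (rebitDensity y).PosDef ∧ (rebitDensityPT y).PosDef} :=
  convex_setOf_posDef_rebitDensity.inter convex_setOf_posDef_rebitDensityPT

/-! ### The closed bodies sit between the open bodies and their closures -/

/-- The open segment from a state to the maximally mixed state consists of faithful states:
`D_ℝ ⊆ closure {ρ ≻ 0}`. [folklore] -/
theorem rebitStateBody_subset_closure :
    rebitStateBody ⊆ closure {y : Fin 9 → ℝ | (rebitDensity y).PosDef} := by
  intro y hy
  have hseg : openSegment ℝ y rebitCentre ⊆ {y : Fin 9 → ℝ | (rebitDensity y).PosDef} := by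
    rw [openSegment_subset_iff]
    intro a b ha hb hab
    simp only [Set.mem_setOf_eq]
    rw [rebitDensity_lineComb a b hab, rebitDensity_rebitCentre]
    exact Matrix.PosDef.posSemidef_add ((mem_rebitStateBody_iff.1 hy).smul ha.le)
      ((Matrix.PosDef.one.smul (by norm_num : (0 : ℝ) < 1 / 4)).smul hb)
  exact closure_mono hseg (segment_subset_closure_openSegment (left_mem_segment ℝ y rebitCentre))

/-- Likewise for the PPT body: `P_ℝ ⊆ closure {ρ ≻ 0 ∧ ρ^Γ ≻ 0}`. [folklore] -/
theorem rebitPPTBody_subset_closure :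
    rebitPPTBody ⊆
      closure {y : Fin 9 → ℝ | (rebitDensity y).PosDef ∧ (rebitDensityPT y).PosDef} := by
  intro y hy
  have hseg : openSegment ℝ y rebitCentre ⊆
      {y : Fin 9 → ℝ | (rebitDensity y).PosDef ∧ (rebitDensityPT y).PosDef} := by
    rw [openSegment_subset_iff]
    intro a b ha hb hab
    simp only [Set.mem_setOf_eq]
    rw [rebitDensity_lineComb a b hab, rebitDensity_rebitCentre, rebitDensityPT_lineComb a b hab,
      rebitDensityPT_rebitCentre]
    exact ⟨Matrix.PosDef.posSemidef_add ((mem_rebitPPTBody_iff.1 hy).1.smul ha.le)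
        ((Matrix.PosDef.one.smul (by norm_num : (0 : ℝ) < 1 / 4)).smul hb),
      Matrix.PosDef.posSemidef_add ((mem_rebitPPTBody_iff.1 hy).2.smul ha.le)
        ((Matrix.PosDef.one.smul (by norm_num : (0 : ℝ) < 1 / 4)).smul hb)⟩
  exact closure_mono hseg (segment_subset_closure_openSegment (left_mem_segment ℝ y rebitCentre))

/-! ### Closed and open bodies have the same volume -/

/-- **`λ₉(D_ℝ) = λ₉{ρ ≻ 0}`**: the closed body of two-rebit states and Lovas–Andai's open body of
faithful states have the same Lebesgue volume (they differ by part of the frontier of a convex set,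
which is null). [cite: LovasAndai2017, §2 (faithful states; the boundary is immaterial for volumes)] -/
theorem volume_rebitStateBody_eq_posDef :
    volume rebitStateBody = volume {y : Fin 9 → ℝ | (twoRebitMatrix y).PosDef} := by
  rw [← rebitDensity_eq_twoRebitMatrix]
  apply le_antisymm
  · calc volume rebitStateBody
        ≤ volume (closure {y : Fin 9 → ℝ | (rebitDensity y).PosDef}) :=
          measure_mono rebitStateBody_subset_closure
      _ = volume {y : Fin 9 → ℝ | (rebitDensity y).PosDef} :=
          measure_closure_of_null_frontier
            (convex_setOf_posDef_rebitDensity.addHaar_frontier volume)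
  · exact measure_mono fun y hy => Matrix.PosDef.posSemidef hy

/-- **`λ₉(P_ℝ) = λ₉{ρ ≻ 0 ∧ ρ^Γ ≻ 0}`**: the closed and the open PPT bodies have the same volume.
[cite: LovasAndai2017, §3 (𝒟ˢ = T(𝒟) ∩ 𝒟; the boundary is immaterial for volumes)] -/
theorem volume_rebitPPTBody_eq_posDef :
    volume rebitPPTBody =
      volume {y : Fin 9 → ℝ | (twoRebitMatrix y).PosDef ∧ (twoRebitMatrixPT y).PosDef} := by
  rw [← rebitDensity_eq_twoRebitMatrix, ← rebitDensityPT_eq_twoRebitMatrixPT]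
  apply le_antisymm
  · calc volume rebitPPTBody
        ≤ volume (closure
            {y : Fin 9 → ℝ | (rebitDensity y).PosDef ∧ (rebitDensityPT y).PosDef}) :=
          measure_mono rebitPPTBody_subset_closure
      _ = volume {y : Fin 9 → ℝ | (rebitDensity y).PosDef ∧ (rebitDensityPT y).PosDef} :=
          measure_closure_of_null_frontier (convex_setOf_posDef_ppt.addHaar_frontier volume)
  · exact measure_mono fun y hy => ⟨Matrix.PosDef.posSemidef hy.1, Matrix.PosDef.posSemidef hy.2⟩

/-! ### The two vendored forms of Theorem 2 are equivalent; reduction to the fibre -/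

/-- **The closed-body and the open-body typings of Lovas–Andai's Theorem 2 are equivalent**:
`LovasAndai2017_rebit_2964` (this topic, `Matrix.PosSemidef`) `↔`
`LovasAndai2017_rebit_separability_probability` (`Literature/Probability/RandomMatrix`,
`Matrix.PosDef`, the source's faithful states). [cite: LovasAndai2017, Theorem 2] -/
theorem LovasAndai2017_rebit_2964_iff_posDef :
    LovasAndai2017_rebit_2964 ↔ LovasAndai2017_rebit_separability_probability := by
  unfold LovasAndai2017_rebit_2964
    Literature.Probability.RandomMatrix.LovasAndai2017_rebit_separability_probability
  rw [volume_rebitStateBody_eq_posDef, volume_rebitPPTBody_eq_posDef]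

/-- **Reduction of `LovasAndai2017_rebit_2964` to the fibre over the maximally mixed marginal**
(the architecture of the printed proof: Corollary 2 — the conditional separability probability
over `𝒟_{4,ℝ}(D)` does not depend on `D` — then the value on one fibre): the closed-body Theorem 2
follows from `64 · λ₇{ρ ≻ 0, T ρ ≻ 0} = 29 · λ₇{ρ ≻ 0}` on the fibre chart `ℝ⁷` of `Tr₂ ρ = ½·1₂`.
[cite: LovasAndai2017, Corollary 2 and Theorem 2] -/
theorem LovasAndai2017_rebit_2964_of_fibre
    (h : LovasAndai2017_rebit_fibre_separability_probability) : LovasAndai2017_rebit_2964 :=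
  LovasAndai2017_rebit_2964_iff_posDef.2
    (Literature.Probability.RandomMatrix.LovasAndai2017.rebit_separability_probability_of_fibre h)

/-- Conversely the closed-body Theorem 2 gives the fibre statement (the transport constant is
positive and finite). [cite: LovasAndai2017, Corollary 2 and Theorem 2] -/
theorem LovasAndai2017_rebit_2964.fibre (h : LovasAndai2017_rebit_2964) :
    LovasAndai2017_rebit_fibre_separability_probability :=
  Literature.Probability.RandomMatrix.LovasAndai2017.rebit_fibre_separability_probability_of_full
    (LovasAndai2017_rebit_2964_iff_posDef.1 h)

end Literature.InformationTheory.Entanglement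

end
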